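import Summits.QuantumFields.BalabanUV.T4Continuum.Spine.NE2BalabanLayer
import Summits.QuantumFields.BalabanUV.T4Continuum.Support.CovariantAveragingBalaban
import Summits.QuantumFields.BalabanUV.T4Continuum.Support.LineAveragingPairingLaw

/-!
# T⁴ programme, spine node NE2 (U1a) — `perturbationLaws_balaban`: the tier-B law with BAŁABAN's OWN covariant-averaging summand
# (row B3.b-inst's END, by name) in the B3 slot of `Spine/NE2BalabanLayer`, and ROOT B for it (row B7 part 2, file 2)

NE2 formalisation swarm, leaf prover 08 (row B7; owner rulings R1/R2/R6/R8).  `Spine/NE2BalabanLayer.perturbationLaws_tierB` assembles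
`covPertC R + P₃ + P₄` from the regularity class (row B5), node NE3's `LocalRate` BY NAME (row B6) and two target-shape slot laws.  Row
B3.b-inst's END `Support/CovariantAveragingBalaban.perturbationLaws_covariantAveraging_balaban` (leaf-01, owner ruling R2's shape) concludes
the target shape for BAŁABAN's summand `a·n_k^d·(Q_k(R_k)ᴴQ_k(R_k) − (Q_kᴴQ_k) ⊗ 1)` — the LINE-SUM averaging `QvOp` that sits inside
`calDa`'s `a•(QvAdj * QvOp)` ([Balaban1984PropagatorsI] (1.18)/(1.69)), covariantly transported (`CovariantBlockAveraging.QcovLev`) — from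
the free inner-pairing law of `Bfree` — row B3.d's LANDED END `LineAveragingPairing.averagingLaws_Bfree` (leaf-06/leaf-07: size 1, pairing
`Cst·L^{−k}`), DISCHARGED here by name — and the transport-error laws `hE` of `Ecov` (rows B3.a′ (iii)/B3.b-conc, DISPLAYED until they land).
Here it is put in slot `P₃`:
 * **`avgPert R`** (the summand as a tower), `avgPert_trivial` (`= 0` at `R = 1`, by `covariantAveraging_balaban_trivial` — the typed operator
   reduces to `Δ_a ⊗ 1` BY CONSTRUCTION, trigger c5), **`balabanPert R P₄ = tierBPert R (avgPert R) P₄`**;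
 * **`perturbationLaws_balaban`**: binders `hreg` (B5), `hNE3 : LocalRate (bgReadings (regClass R)) C L⁻¹` (NE3 BY NAME), `hE` (the
   transport-error laws of `Ecov`, rows B3.a′ (iii)/B3.b-conc), `hP₄` (row B4.b's END in the target shape, a displayed slot) ⟹ the target
   shape for `balabanPert R P₄` with `κ = kappaB o d a α β C (kappaQ d a a ε) κ₄`, `C₂ = C2B o d L a α β C (a·C2gram Cst 1 ε (2dCst) CJ Cst Cδ) C₄`;
 * **`balaban_root`** (named limit + rate `L^{−k}` + NE2-LIP + holomorphy, every `‖t‖κ < 1`) and **`balaban_rate_at_one`** (`t = 1` under the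
   DISPLAYED threshold `κ < 1`), by `NE2BalabanLayer.tierB_root` / `tierB_rate_at_one`;
 * the threshold made EXPLICIT: **`Kstar o d a = (card o)²·d·Cst·(4·card o + 7) + 3a·Cst + 1`**, `kappaB_le_of_small` (all smallness data
   `≤ η ≤ 1` ⟹ `κ_B ≤ η·K⋆`), **`balaban_rate_of_small`** (`η·K⋆ < 1` ⟹ the `t = 1` rate) — the skeleton's «α₁ ≤ α₁⋆(d, a) EXPLICIT».

HONEST FRAMING (T4-DAG p. 1).  Assembly only; MODEL LEVEL (colour transporters `R` are DATA — no group structure, no assertion that they are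
Bałaban's minimisers `U_k(V)`; the free operator is the VECTOR `Δ_a ⊗ 1`; GLOBAL small field; no assertion of the dictionary B0, c5); ROOT B
here is CONDITIONAL on node NE3's `LocalRate` (c2/c7), on the regularity class (c3), on rows B3.a′ (iii)/B3.b-conc's transport-error laws
(displayed; row B3.d's free law is DISCHARGED by name) and on row B4.b's END (displayed slot, c4); carver's scope ruling c1 stands; NOT [B9] (3.23)–(3.26) as printed; **NE2 NOT PROVED**; NOT
infinite volume, NOT a mass gap, NOT Clay, NOT summit progress; spine 0/9 unchanged.  HONEST DEPENDENCY: continuum YM on T⁴ ⇐ BetaPertH ∧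
nine spine estimates (0/9 proved); BetaPertH ⇐ (D1) ∧ (D4) ∧ CAP+tail; G-an2-4 gates asym, D1 and NE2/3/4.  ABSOLUTE RULE kept; no `sorry`.
-/

noncomputable section

open scoped BigOperators ComplexConjugate Matrix Matrix.Norms.L2Operator Kronecker
open Filter Topology

namespace Summit.QuantumFields.BalabanUV.T4Continuum.NE2BalabanRoot

open Literature.MathematicalPhysics.QuantumFieldTheory.Balaban1983to89.B5Prop11Plancherel (Cst Cst_nonneg)
open Literature.MathematicalPhysics.QuantumFieldTheory.Balaban1983to89.B5Block118 (QvOp)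
open Literature.MathematicalPhysics.QuantumFieldTheory.Balaban1983to89.B5G183RateUnitTower (lev lev_neZero)
open Literature.MathematicalPhysics.QuantumFieldTheory.Balaban1983to89.T4EtaRateMin (LocalRate)
open Summit.QuantumFields.BalabanUV.T4Continuum
open Summit.QuantumFields.BalabanUV.T4Continuum.CovariantAveragingTower (TowerLimitRate)
open Summit.QuantumFields.BalabanUV.T4Continuum.BalabanAveragedTowerUnit (idx Qlev)
open Summit.QuantumFields.BalabanUV.T4Continuum.BackgroundResolventTower
open Summit.QuantumFields.BalabanUV.T4Continuum.KingPairingPlantedLaw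
open Summit.QuantumFields.BalabanUV.T4Continuum.NE2PerturbedLayer
open Summit.QuantumFields.BalabanUV.T4Continuum.KroneckerLift
open Summit.QuantumFields.BalabanUV.T4Continuum.GramPerturbationLaw (AveragingLaws C2gram)
open Summit.QuantumFields.BalabanUV.T4Continuum.NE2FromNE3 (bgReadings)
open Summit.QuantumFields.BalabanUV.T4Continuum.RegularBackgroundTower (RegularTransporters regClass)
open Summit.QuantumFields.BalabanUV.T4Continuum.CovariantBlockAveraging (Bfree QcovLev Ecov)
open Summit.QuantumFields.BalabanUV.T4Continuum.CovariantAveragingSummand (kappaQ kappaQ_ofReal)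
open Summit.QuantumFields.BalabanUV.T4Continuum.CovariantAveragingBalaban
open Summit.QuantumFields.BalabanUV.T4Continuum.NE2ColourPerturbedLayer
open Summit.QuantumFields.BalabanUV.T4Continuum.NE2BalabanLayer

variable {d : ℕ} (L : ℕ) [NeZero L] (M : Fin d → ℕ) [hM : ∀ μ, NeZero (M μ)] (a : ℝ) (ha : 0 < a)
variable {o : Type*} [Fintype o] [DecidableEq o]

/-- **BAŁABAN's COVARIANT-AVERAGING SUMMAND** as a tower: `a·n_k^d·(Q_k(R_k)ᴴQ_k(R_k) − (Q_kᴴQ_k) ⊗ 1)` (row B3.b-inst's typed operator; line-sum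
averaging `QvOp`, covariant version `QcovLev`). [cite: Balaban1984PropagatorsI, (1.18) p.20, (1.69) p.29; Balaban1985BackgroundPropagators,
(3.16) p.393, (3.26) p.395 (shapes)] [folklore] -/
def avgPert (R : (k : ℕ) → Fin d → (idx L M k → Matrix o o ℂ)) (k : ℕ) : Matrix (idx L M k × o) (idx L M k × o) ℂ :=
  (a : ℂ) • ((((lev L k : ℕ) : ℂ) ^ d) • ((QcovLev L M R k)ᴴ * QcovLev L M R k
    - ((QvOp (lev L k) M)ᴴ * QvOp (lev L k) M) ⊗ₖ (1 : Matrix o o ℂ)))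

omit [NeZero L] in
/-- at the trivial background the summand VANISHES (`Q_k(1) = Q_k ⊗ 1`), so `Δ_a ⊗ 1 + balabanPert` reduces to `Δ_a ⊗ 1 + P₄` there BY
CONSTRUCTION (c5). [folklore] -/
theorem avgPert_trivial (k : ℕ) : avgPert L M a (fun _ _ _ => (1 : Matrix o o ℂ)) k = 0 :=
  covariantAveraging_balaban_trivial L M o (a : ℂ) k

/-- **THE BAŁABAN TIER-B PERTURBATION** `(Δ^{R_k} − Δ^1 ⊗ 1) + a·n_k^d·(Q_k(R_k)ᴴQ_k(R_k) − (Q_kᴴQ_k) ⊗ 1) + P₄,k` — rows B2 + B3.b-inst +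
the gauge-term slot. [cite: Balaban1985BackgroundPropagators, (3.26) p.395 (shape)] [folklore] -/
def balabanPert (R : (k : ℕ) → Fin d → (idx L M k → Matrix o o ℂ)) (P₄ : (k : ℕ) → Matrix (idx L M k × o) (idx L M k × o) ℂ) :
    (k : ℕ) → Matrix (idx L M k × o) (idx L M k × o) ℂ :=
  tierBPert L M R (avgPert L M a R) P₄

/-- **`perturbationLaws_balaban`** (`d ≥ 1`): the target shape for `balabanPert R P₄`, every binder displayed — `hreg` (row B5's
(3.35)-shape), `hNE3 : LocalRate (bgReadings (regClass R)) C L⁻¹` (node NE3 BY NAME), the transport-error laws `hE` (rows B3.a′ (iii)/B3.b-conc,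
displayed; the free inner-pairing law of the line-sum averaging, row B3.d, is DISCHARGED by `LineAveragingPairing.averagingLaws_Bfree`), via
leaf-01's END `perturbationLaws_covariantAveraging_balaban`; and the gauge-term slot law `hP₄` (row B4.b).  Constants
`κ = kappaB … (kappaQ d a a ε) κ₄`, `C₂ = C2B … (a·C2gram Cst 1 ε (2dCst) CJ Cst Cδ) C₄`.
[cite: Balaban1985BackgroundPropagators, (3.26) p.395, (3.35) p.396 (shapes)] [folklore] -/
theorem perturbationLaws_balaban (hd : 1 ≤ d) {R : (k : ℕ) → Fin d → (idx L M k → Matrix o o ℂ)} {α β : ℝ}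
    (hreg : RegularTransporters L M R α β) {C : ℝ} (hC : 0 ≤ C) (hNE3 : LocalRate (bgReadings L M (regClass L M R)) C ((L : ℝ)⁻¹))
    {ε Cδ : ℝ} (hε : 0 ≤ ε)
    (hE : AveragingLaws (fun k => calDalev L M a ha k ⊗ₖ (1 : Matrix o o ℂ)) (Ecov L M R)
      (fun k => JpcT L M k ⊗ₖ (1 : Matrix o o ℂ)) ε (fun k => Cδ * ((L : ℝ)⁻¹) ^ k))
    {P₄ : (k : ℕ) → Matrix (idx L M k × o) (idx L M k × o) ℂ} {κ₄ C₄ : ℝ}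
    (hP₄ : PerturbationLaws (fun k => calDalev L M a ha k ⊗ₖ (1 : Matrix o o ℂ)) P₄ (fun k => JpcT L M k ⊗ₖ (1 : Matrix o o ℂ)) κ₄
      (fun k => C₄ * ((L : ℝ)⁻¹) ^ k)) :
    PerturbationLaws (fun k => calDalev L M a ha k ⊗ₖ (1 : Matrix o o ℂ)) (balabanPert L M a R P₄)
      (fun k => JpcT L M k ⊗ₖ (1 : Matrix o o ℂ)) (kappaB o d a α β C (kappaQ d a (a : ℂ) ε) κ₄)
      (fun k => C2B o d L a α β C (a * C2gram (Cst d a) 1 ε (2 * d * Cst d a) (CJ d a) (Cst d a) Cδ) C₄ * ((L : ℝ)⁻¹) ^ k) :=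
  perturbationLaws_tierB L M a ha hd hreg hC hNE3 (perturbationLaws_covariantAveraging_balaban L M a ha o hε (LineAveragingPairing.averagingLaws_Bfree L M a ha) hE) hP₄

/-- **ROOT B FOR THE BAŁABAN TIER-B PERTURBATION** (`L ≥ 2`, `d ≥ 1`), every binder displayed: for every coupling `‖t‖κ < 1` the lifted
King-averaged unit-lattice colour covariances of `(Δ_a^{(k)} ⊗ 1 + t·P_k)⁻¹`, `P = balabanPert R P₄`, CONVERGE to the NAMED limit with
`‖c_k(t) − c_∞(t)‖ ≤ Cpert(t)·L^{−k}/(1 − L^{−1})`, NE2-LIP `‖c_∞(t) − c_∞(0)‖ ≤ ‖t‖κ·Cst·(1 − ‖t‖κ)^{−1}`, and `c_∞` HOLOMORPHIC on the Neumann disc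
— CONDITIONAL on `hNE3` (node NE3), `hreg`, `hE`, `hP₄`.  NE2 is NOT proved by this. [cite: King1986, Lemma 4.5 (4.32)/(4.38) p.674
(scalar template); Balaban1985BackgroundPropagators, (3.26) p.395 (shape)] [folklore] -/
theorem balaban_root (hL : 2 ≤ L) (hd : 1 ≤ d) {R : (k : ℕ) → Fin d → (idx L M k → Matrix o o ℂ)} {α β : ℝ}
    (hreg : RegularTransporters L M R α β) {C : ℝ} (hC : 0 ≤ C) (hNE3 : LocalRate (bgReadings L M (regClass L M R)) C ((L : ℝ)⁻¹))
    {ε Cδ : ℝ} (hε : 0 ≤ ε)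
    (hE : AveragingLaws (fun k => calDalev L M a ha k ⊗ₖ (1 : Matrix o o ℂ)) (Ecov L M R)
      (fun k => JpcT L M k ⊗ₖ (1 : Matrix o o ℂ)) ε (fun k => Cδ * ((L : ℝ)⁻¹) ^ k))
    {P₄ : (k : ℕ) → Matrix (idx L M k × o) (idx L M k × o) ℂ} {κ₄ C₄ : ℝ}
    (hP₄ : PerturbationLaws (fun k => calDalev L M a ha k ⊗ₖ (1 : Matrix o o ℂ)) P₄ (fun k => JpcT L M k ⊗ₖ (1 : Matrix o o ℂ)) κ₄
      (fun k => C₄ * ((L : ℝ)⁻¹) ^ k)) {t : ℂ} (ht : ‖t‖ * kappaB o d a α β C (kappaQ d a (a : ℂ) ε) κ₄ < 1) :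
    Tendsto (pertCovC L M a ha (balabanPert L M a R P₄) t) atTop (𝓝 (pertLimC L M a ha (balabanPert L M a R P₄) t)) ∧
      Tendsto (pertCovC L M a ha (balabanPert L M a R P₄) 0) atTop (𝓝 (pertLimC L M a ha (balabanPert L M a R P₄) 0)) ∧
      (∀ k, ‖pertCovC L M a ha (balabanPert L M a R P₄) t k - pertLimC L M a ha (balabanPert L M a R P₄) t‖
          ≤ Cpert (kappaB o d a α β C (kappaQ d a (a : ℂ) ε) κ₄) (2 * d * Cst d a) (CJ d a)
              (C2B o d L a α β C (a * C2gram (Cst d a) 1 ε (2 * d * Cst d a) (CJ d a) (Cst d a) Cδ) C₄) 0 t * ((L : ℝ)⁻¹) ^ k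
              / (1 - (L : ℝ)⁻¹)) ∧
      ‖pertLimC L M a ha (balabanPert L M a R P₄) t - pertLimC L M a ha (balabanPert L M a R P₄) 0‖
          ≤ ‖t‖ * kappaB o d a α β C (kappaQ d a (a : ℂ) ε) κ₄ * Cst d a * (1 - ‖t‖ * kappaB o d a α β C (kappaQ d a (a : ℂ) ε) κ₄)⁻¹ ∧
      DifferentiableOn ℂ (pertLimC L M a ha (balabanPert L M a R P₄)) {t : ℂ | ‖t‖ * kappaB o d a α β C (kappaQ d a (a : ℂ) ε) κ₄ < 1} :=
  tierB_root L M a ha hL hd hreg hC hNE3 (perturbationLaws_covariantAveraging_balaban L M a ha o hε (LineAveragingPairing.averagingLaws_Bfree L M a ha) hE) hP₄ ht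

/-- **THE PHYSICAL VALUE `t = 1`** under the DISPLAYED small-field threshold `κ = kappaB … (a·ε(2+ε)Cst) κ₄ < 1`: the lifted King-averaged
unit-lattice covariances of `(Δ_a^{(k)} ⊗ 1 + P_k)⁻¹`, `P = balabanPert R P₄`, CONVERGE with rate `L^{−k}` — CONDITIONAL on `hNE3`, `hreg`,
`hE`, `hP₄`, all displayed.  NE2 is NOT proved by this. [folklore] -/
theorem balaban_rate_at_one (hL : 2 ≤ L) (hd : 1 ≤ d) {R : (k : ℕ) → Fin d → (idx L M k → Matrix o o ℂ)} {α β : ℝ}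
    (hreg : RegularTransporters L M R α β) {C : ℝ} (hC : 0 ≤ C) (hNE3 : LocalRate (bgReadings L M (regClass L M R)) C ((L : ℝ)⁻¹))
    {ε Cδ : ℝ} (hε : 0 ≤ ε)
    (hE : AveragingLaws (fun k => calDalev L M a ha k ⊗ₖ (1 : Matrix o o ℂ)) (Ecov L M R)
      (fun k => JpcT L M k ⊗ₖ (1 : Matrix o o ℂ)) ε (fun k => Cδ * ((L : ℝ)⁻¹) ^ k))
    {P₄ : (k : ℕ) → Matrix (idx L M k × o) (idx L M k × o) ℂ} {κ₄ C₄ : ℝ}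
    (hP₄ : PerturbationLaws (fun k => calDalev L M a ha k ⊗ₖ (1 : Matrix o o ℂ)) P₄ (fun k => JpcT L M k ⊗ₖ (1 : Matrix o o ℂ)) κ₄
      (fun k => C₄ * ((L : ℝ)⁻¹) ^ k)) (hsmall : kappaB o d a α β C (a * (ε * (2 + ε) * Cst d a)) κ₄ < 1) :
    TowerLimitRate (fun k => Qlev L M k ⊗ₖ (1 : Matrix o o ℂ)) ((L : ℝ) ^ d)
      (fun k => (calDalev L M a ha k ⊗ₖ (1 : Matrix o o ℂ) + balabanPert L M a R P₄ k)⁻¹)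
      (Cpert (kappaB o d a α β C (a * (ε * (2 + ε) * Cst d a)) κ₄) (2 * d * Cst d a) (CJ d a)
        (C2B o d L a α β C (a * C2gram (Cst d a) 1 ε (2 * d * Cst d a) (CJ d a) (Cst d a) Cδ) C₄) 0 1) ((L : ℝ)⁻¹) := by
  have h := tierB_rate_at_one L M a ha hL hd hreg hC hNE3 (perturbationLaws_covariantAveraging_balaban L M a ha o hε (LineAveragingPairing.averagingLaws_Bfree L M a ha) hE) hP₄
  rw [kappaQ_ofReal ha.le] at h
  exact h hsmall

/-! ## The small-field threshold made EXPLICIT in `(card o, d, a)` -/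

/-- the explicit threshold constant `K⋆ = (card o)²·d·Cst·(4·card o + 7) + 3a·Cst + 1` (OURS). [folklore] -/
def Kstar (o : Type*) [Fintype o] (d : ℕ) (a : ℝ) : ℝ :=
  (Fintype.card o : ℝ) ^ 2 * (d * Cst d a * (4 * Fintype.card o + 7)) + 3 * a * Cst d a + 1

omit [DecidableEq o] in
/-- **THE SMALL-FIELD THRESHOLD, EXPLICIT**: if every smallness datum (`α, β` of the regularity class, NE3's constant `C`, the transport size
`ε`, the gauge slot's `κ₄`) is `≤ η ≤ 1`, then `κ_B ≤ η·K⋆(card o, d, a)`; so `η < 1/K⋆` puts the physical coupling `t = 1` inside the Neumann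
disc.  (Crude but explicit; OURS.) [folklore] -/
theorem kappaB_le_of_small (ha0 : 0 ≤ a) {α β C ε κ₄ η : ℝ} (hα : 0 ≤ α) (hε : 0 ≤ ε) (hαη : α ≤ η)
    (hβη : β ≤ η) (hCη : C ≤ η) (hεη : ε ≤ η) (hκη : κ₄ ≤ η) (hη1 : η ≤ 1) :
    kappaB o d a α β C (a * (ε * (2 + ε) * Cst d a)) κ₄ ≤ η * Kstar o d a := by
  have hCst := Cst_nonneg d a
  have hm : (0 : ℝ) ≤ Fintype.card o := Nat.cast_nonneg _
  have hd : (0 : ℝ) ≤ d := Nat.cast_nonneg _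
  have hη : 0 ≤ η := hα.trans hαη
  have hmax : max β (RegularBackgroundTower.betaNE3 o C) ≤ (2 * Fintype.card o + 1) * η := by
    refine max_le (by nlinarith) ?_
    unfold RegularBackgroundTower.betaNE3
    nlinarith [mul_le_mul_of_nonneg_left hCη hm]
  have hsq : α ^ 2 ≤ η := by nlinarith
  -- the three pieces
  have h1 : d * (α + max β (RegularBackgroundTower.betaNE3 o C)) * Cst d a ≤ d * ((2 * Fintype.card o + 2) * η) * Cst d a := by
    have : α + max β (RegularBackgroundTower.betaNE3 o C) ≤ (2 * Fintype.card o + 2) * η := by linarith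
    exact mul_le_mul_of_nonneg_right (mul_le_mul_of_nonneg_left this hd) hCst
  have h2 : d * (α ^ 2 + 2 * β) * Cst d a ≤ d * (3 * η) * Cst d a := by
    have : α ^ 2 + 2 * β ≤ 3 * η := by linarith
    exact mul_le_mul_of_nonneg_right (mul_le_mul_of_nonneg_left this hd) hCst
  have h3 : a * (ε * (2 + ε) * Cst d a) ≤ a * (3 * η * Cst d a) := by
    have : ε * (2 + ε) ≤ 3 * η := by nlinarith
    exact mul_le_mul_of_nonneg_left (mul_le_mul_of_nonneg_right this hCst) ha0
  have h12 : (Fintype.card o : ℝ) ^ 2 * (2 * (d * (α + max β (RegularBackgroundTower.betaNE3 o C)) * Cst d a)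
        + d * (α ^ 2 + 2 * β) * Cst d a)
      ≤ (Fintype.card o : ℝ) ^ 2 * (2 * (d * ((2 * Fintype.card o + 2) * η) * Cst d a) + d * (3 * η) * Cst d a) :=
    mul_le_mul_of_nonneg_left (by linarith) (sq_nonneg _)
  unfold kappaB ColourCovariantLaplacian.kappaCol Kstar
  have e : (Fintype.card o : ℝ) ^ 2 * (2 * (d * ((2 * Fintype.card o + 2) * η) * Cst d a) + d * (3 * η) * Cst d a)
      + a * (3 * η * Cst d a) + η
      = η * ((Fintype.card o : ℝ) ^ 2 * (d * Cst d a * (4 * Fintype.card o + 7)) + 3 * a * Cst d a + 1) := by ring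
  linarith [h12, h3, hκη, e.le]

omit [DecidableEq o] in
/-- hence `η·K⋆ < 1` gives `κ_B < 1`. [folklore] -/
theorem kappaB_lt_one_of_small (ha0 : 0 ≤ a) {α β C ε κ₄ η : ℝ} (hα : 0 ≤ α) (hε : 0 ≤ ε) (hαη : α ≤ η)
    (hβη : β ≤ η) (hCη : C ≤ η) (hεη : ε ≤ η) (hκη : κ₄ ≤ η) (hη1 : η ≤ 1) (hηK : η * Kstar o d a < 1) :
    kappaB o d a α β C (a * (ε * (2 + ε) * Cst d a)) κ₄ < 1 :=
  (kappaB_le_of_small a ha0 hα hε hαη hβη hCη hεη hκη hη1).trans_lt hηK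

/-- **ROOT B AT `t = 1` WITH THE EXPLICIT THRESHOLD** (`L ≥ 2`, `d ≥ 1`): all smallness data `≤ η ≤ 1` and `η·K⋆(card o, d, a) < 1` ⟹ the
lifted King-averaged unit-lattice covariances of `(Δ_a^{(k)} ⊗ 1 + balabanPert R P₄ k)⁻¹` CONVERGE with rate `L^{−k}` — CONDITIONAL on `hNE3`
(node NE3, with constant `C ≤ η`), `hreg` (regularity class `α, β ≤ η`), `hE` (rows B3, transport size `ε ≤ η`), `hP₄` (row B4.b, `κ₄ ≤ η`).
NE2 is NOT proved by this. [folklore] -/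
theorem balaban_rate_of_small (hL : 2 ≤ L) (hd : 1 ≤ d) {R : (k : ℕ) → Fin d → (idx L M k → Matrix o o ℂ)} {α β : ℝ}
    (hreg : RegularTransporters L M R α β) {C : ℝ} (hC : 0 ≤ C) (hNE3 : LocalRate (bgReadings L M (regClass L M R)) C ((L : ℝ)⁻¹))
    {ε Cδ : ℝ} (hε : 0 ≤ ε)
    (hE : AveragingLaws (fun k => calDalev L M a ha k ⊗ₖ (1 : Matrix o o ℂ)) (Ecov L M R)
      (fun k => JpcT L M k ⊗ₖ (1 : Matrix o o ℂ)) ε (fun k => Cδ * ((L : ℝ)⁻¹) ^ k))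
    {P₄ : (k : ℕ) → Matrix (idx L M k × o) (idx L M k × o) ℂ} {κ₄ C₄ : ℝ}
    (hP₄ : PerturbationLaws (fun k => calDalev L M a ha k ⊗ₖ (1 : Matrix o o ℂ)) P₄ (fun k => JpcT L M k ⊗ₖ (1 : Matrix o o ℂ)) κ₄
      (fun k => C₄ * ((L : ℝ)⁻¹) ^ k)) {η : ℝ} (hαη : α ≤ η) (hβη : β ≤ η) (hCη : C ≤ η) (hεη : ε ≤ η) (hκη : κ₄ ≤ η)
    (hη1 : η ≤ 1) (hηK : η * Kstar o d a < 1) :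
    TowerLimitRate (fun k => Qlev L M k ⊗ₖ (1 : Matrix o o ℂ)) ((L : ℝ) ^ d)
      (fun k => (calDalev L M a ha k ⊗ₖ (1 : Matrix o o ℂ) + balabanPert L M a R P₄ k)⁻¹)
      (Cpert (kappaB o d a α β C (a * (ε * (2 + ε) * Cst d a)) κ₄) (2 * d * Cst d a) (CJ d a)
        (C2B o d L a α β C (a * C2gram (Cst d a) 1 ε (2 * d * Cst d a) (CJ d a) (Cst d a) Cδ) C₄) 0 1) ((L : ℝ)⁻¹) :=
  balaban_rate_at_one L M a ha hL hd hreg hC hNE3 hε hE hP₄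
    (kappaB_lt_one_of_small a ha.le hreg.nonneg.1 hε hαη hβη hCη hεη hκη hη1 hηK)

end Summit.QuantumFields.BalabanUV.T4Continuum.NE2BalabanRoot

end
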